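import Summits.CriticalPhenomena.SAWScalingLimit.Theorems.SAWDefectDecoherenceBoundaryClosureRGateStabilityRoot
import Summits.CriticalPhenomena.SAWScalingLimit.Theorems.SAWDefectDecoherenceBoundaryClosureRTransportFrame
import Mathlib.MeasureTheory.Function.Jacobian
import Literature.Analysis.Complex.LengthArea
import HarnessLib

/-!
# `BoundaryClosureR` (stmt-CriticalPhenomena-14004), line `polygon-parity-squeeze`, stub
# `transportRigidity` (E), part F5b: decay of the transported observable at infinity

Hypothesis `hinf` of `realLine_rigidity` for the transported observable
`K = (g · e^{-(5/8)(L - L_b)}) ∘ Φ⁻¹`:  `‖K w‖ · ‖w‖^{-11/4} ∈ L¹(ℍ ∩ {‖w‖ > R})`.  Large `‖w‖`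
corresponds to `z = Φ⁻¹ w` near the ROOT `a = D.pt 0` (`frame_localise_infty`), where the flat
root piece gives the reflection `h` of `1/Φ` (`GateStability.exists_rootReflection`: holomorphic,
injective, `h(a) = 0`, `h Φ = 1`).  Changing variables `w = Φ z` (`dA(w) = |Φ'|² dA(z)`), the
weight becomes `|Φ'|^{2 - 5/8} |Φ|^{-11/4} = (|h'|/|h|²)^{11/8} |h|^{11/4} = |h'|^{11/8}`, which is
BOUNDED near the root; so `hinf` reduces to the integrability of `g` near the root.

References: Pommerenke, *Boundary Behaviour of Conformal Maps* (1992), Thm. 2.6.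
-/

noncomputable section

open scoped Topology
open Filter Set Metric Complex MeasureTheory
open UpperHalfPlane (upperHalfPlaneSet)
open Literature.Probability.RandomPlanarGeometry
open Summit.CriticalPhenomena.SAWScalingLimit.Theorems.PickHalfPlane

namespace Summit.CriticalPhenomena.SAWScalingLimit.Theorems.PolygonParitySqueeze

namespace Transport

/-- Real-power bookkeeping at the root: `(a/b²)² · (a/b²)^{-5/8} · (b⁻¹)^{-11/4} = a^{11/8}` for
`a, b > 0`. [folklore] -/
theorem root_weight_identity {a b : ℝ} (ha : 0 < a) (hb : 0 < b) :
    (a / b ^ 2) ^ 2 * (a / b ^ 2) ^ (-(5 / 8 : ℝ)) * b⁻¹ ^ (-(11 / 4 : ℝ)) = a ^ (11 / 8 : ℝ) := by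
  have hq : 0 < a / b ^ 2 := by positivity
  have h1 : (a / b ^ 2) ^ 2 * (a / b ^ 2) ^ (-(5 / 8 : ℝ)) = (a / b ^ 2) ^ (11 / 8 : ℝ) := by
    rw [show ((a / b ^ 2) ^ 2 : ℝ) = (a / b ^ 2) ^ (2 : ℝ) by norm_cast, ← Real.rpow_add hq]
    norm_num
  have h2 : (a / b ^ 2) ^ (11 / 8 : ℝ) = a ^ (11 / 8 : ℝ) / b ^ (11 / 4 : ℝ) := by
    rw [Real.div_rpow ha.le (by positivity), show (b ^ 2 : ℝ) = b ^ (2 : ℝ) by norm_cast,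
      ← Real.rpow_mul hb.le]
    norm_num
  have h3 : b⁻¹ ^ (-(11 / 4 : ℝ)) = b ^ (11 / 4 : ℝ) := by
    rw [Real.inv_rpow hb.le, Real.rpow_neg hb.le, inv_inv]
  rw [h1, h2, h3, div_mul_cancel₀ _ (Real.rpow_pos_of_pos hb _).ne']

/-- **Decay of the transported observable at infinity** (hypothesis `hinf` of
`realLine_rigidity`): see the module docstring. [cite: PommerenkeBBCM1992, Thm. 2.6] -/
theorem root_decay (D : DobrushinDomain) (Φ : ConformalEquiv D.carrier upperHalfPlaneSet)
    (hΦ0 : Tendsto (fun z => ‖Φ z‖) (𝓝[D.carrier] (D.pt 0)) atTop)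
    (hΦ1 : Φ.HasBoundaryValue (D.pt 1) 0)
    {Φs : ℂ → ℂ} (hΦsc : ContinuousOn Φs (closure D.carrier \ {D.pt 0}))
    (hΦse : EqOn Φs Φ D.carrier)
    {L : ℂ → ℂ} {Lb : ℂ} (hL : ContinuousOn L D.carrier)
    (hexp : ∀ z ∈ D.carrier, Complex.exp (L z) = deriv Φ z)
    {g : ℂ → ℂ} (hgi : ∀ K : Set ℂ, IsCompact K → IntegrableOn g (K ∩ D.carrier))
    {r₀ : ℝ} (hr₀ : 0 < r₀)
    (hflat : D.carrier ∩ ball (D.pt 0) r₀ = {z : ℂ | (D.pt 0).im < z.im} ∩ ball (D.pt 0) r₀)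
    {K : ℂ → ℂ}
    (hK : ∀ w : ℂ, 0 < w.im → K w = g (Φ.symm w) * Complex.exp (-(5 / 8 : ℂ) * (L (Φ.symm w) - Lb))) :
    ∃ R : ℝ, IntegrableOn (fun w => ‖K w‖ * ‖w‖ ^ (-(11 / 4 : ℝ)))
      ({w : ℂ | 0 < w.im} ∩ {w : ℂ | R < ‖w‖}) := by
  have hU : IsOpen D.carrier := D.isOpen
  -- the flat root disc `B(a, R₀)` with the normaliser outside
  set a : ℂ := D.pt 0 with ha
  have h01 : a ≠ D.pt 1 := fun h => absurd (D.pt_injective h) (by decide)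
  set R₀ : ℝ := min r₀ (dist a (D.pt 1)) with hR₀
  have hR₀0 : 0 < R₀ := lt_min hr₀ (dist_pos.2 h01)
  have hflat₀ : D.carrier ∩ ball a R₀ = {z : ℂ | a.im < z.im} ∩ ball a R₀ :=
    Engine.flat_of_subset hflat rfl (ball_subset_ball (min_le_left _ _))
  have h1 : D.pt 1 ∉ ball a R₀ := fun h => by
    have := mem_ball'.1 h
    exact not_lt.2 (min_le_right r₀ (dist a (D.pt 1))) this
  obtain ⟨h, hhd, hhinj, -, hhΦ⟩ := GateStability.exists_rootReflection D hR₀0 hflat₀ h1 Φ hΦ0 hΦ1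
  -- bounds for `h'` on `closedBall a (R₀/2)`
  have hh'c : ContinuousOn (deriv h) (ball a R₀) := ((hhd.analyticOnNhd isOpen_ball).deriv).continuousOn
  have hcb : closedBall a (R₀ / 2) ⊆ ball a R₀ := closedBall_subset_ball (by linarith)
  obtain ⟨Ch, hCh⟩ := (isCompact_closedBall a (R₀ / 2)).exists_bound_of_continuousOn (hh'c.mono hcb)
  -- `Φ = 1/h`, `Φ' = -h'/h²` on `Ω ∩ B(a, R₀)`
  have hopen : IsOpen (D.carrier ∩ ball a R₀) := hU.inter isOpen_ball
  have hh0 : ∀ z ∈ D.carrier ∩ ball a R₀, h z ≠ 0 := fun z hz h0 => by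
    have := hhΦ z hz; rw [h0, zero_mul] at this; exact zero_ne_one this
  have hΦinv : ∀ z ∈ D.carrier ∩ ball a R₀, Φ z = (h z)⁻¹ := fun z hz =>
    eq_inv_of_mul_eq_one_right (hhΦ z hz)
  have hΦ' : ∀ z ∈ D.carrier ∩ ball a R₀, deriv Φ z = -deriv h z / h z ^ 2 := by
    intro z hz
    have hev : (Φ : ℂ → ℂ) =ᶠ[𝓝 z] fun w => (h w)⁻¹ := by
      filter_upwards [hopen.mem_nhds hz] with w hw
      exact hΦinv w hw
    rw [hev.deriv_eq]
    exact ((hhd.differentiableAt (isOpen_ball.mem_nhds hz.2)).hasDerivAt.inv (hh0 z hz)).deriv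
  have hh'0 : ∀ z ∈ ball a R₀, deriv h z ≠ 0 := fun z hz =>
    Literature.Analysis.Complex.SCV.deriv_ne_zero_of_injOn hhd isOpen_ball hhinj hz
  -- localisation: `‖Φ z‖ > R` forces `z ∈ B(a, R₀/2)`
  obtain ⟨R₁, hR₁⟩ := frame_localise_infty (D := D) hΦsc hΦse (half_pos hR₀0)
  set R : ℝ := max R₁ 1 with hR
  refine ⟨R, ?_⟩
  -- the region `S = {z ∈ Ω | ‖Φ z‖ > R}` and its image
  set S : Set ℂ := D.carrier ∩ (Φ : ℂ → ℂ) ⁻¹' {w : ℂ | R < ‖w‖} with hS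
  have hSo : IsOpen S := Φ.continuousOn.isOpen_inter_preimage hU (isOpen_lt continuous_const continuous_norm)
  have hSm : MeasurableSet S := hSo.measurableSet
  have hSa : S ⊆ D.carrier ∩ ball a R₀ := fun z hz =>
    ⟨hz.1, ball_subset_ball (by linarith) (mem_ball.2 (hR₁ z hz.1 (lt_of_le_of_lt (le_max_left _ _) hz.2)))⟩
  have hSb : S ⊆ closedBall a (R₀ / 2) := fun z hz =>
    ball_subset_closedBall (mem_ball.2 (hR₁ z hz.1 (lt_of_le_of_lt (le_max_left _ _) hz.2)))
  have hSimg : (Φ : ℂ → ℂ) '' S = {w : ℂ | 0 < w.im} ∩ {w : ℂ | R < ‖w‖} := by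
    apply Subset.antisymm
    · rintro _ ⟨z, hz, rfl⟩; exact ⟨Φ.mapsTo hz.1, hz.2⟩
    · rintro w ⟨hwim, hwR⟩
      exact ⟨Φ.symm w, ⟨Φ.symm_mapsTo hwim, by simpa [Φ.apply_symm_apply hwim] using hwR⟩,
        Φ.apply_symm_apply hwim⟩
  -- change of variables
  have hd : ∀ z ∈ S, HasFDerivWithinAt (Φ : ℂ → ℂ)
      ((ContinuousLinearMap.smulRight (1 : ℂ →L[ℂ] ℂ) (deriv Φ z)).restrictScalars ℝ) S z :=
    fun z hz => ((Φ.differentiableOn.differentiableAt (hU.mem_nhds hz.1)).hasDerivAt.hasFDerivAt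
      |>.restrictScalars ℝ).hasFDerivWithinAt
  rw [← hSimg]
  refine (integrableOn_image_iff_integrableOn_abs_det_fderiv_smul volume hSm hd (Φ.injOn.mono fun z hz => hz.1)
    (fun w => ‖K w‖ * ‖w‖ ^ (-(11 / 4 : ℝ)))).2 ?_
  -- the pulled-back integrand is `W · ‖g‖` with `W ≤ e^{(5/8) re Lb} Ch^{11/8}`
  set W : ℂ → ℝ := fun z => ‖deriv Φ z‖ ^ 2 * (Real.exp (-(5 / 8 : ℝ) * ((L z).re - Lb.re)) *
    ‖Φ z‖ ^ (-(11 / 4 : ℝ))) with hW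
  have hΦ'c : ContinuousOn (deriv (Φ : ℂ → ℂ)) D.carrier :=
    ((Φ.differentiableOn.analyticOnNhd hU).deriv).continuousOn
  have hΦn0 : ∀ z ∈ D.carrier, ‖Φ z‖ ≠ 0 := fun z hz => by
    have : 0 < (Φ z).im := Φ.mapsTo hz
    exact norm_ne_zero_iff.2 fun h0 => by rw [h0] at this; simp at this
  have hWc : ContinuousOn W S := by
    refine ((hΦ'c.mono fun z hz => hz.1).norm.pow 2).mul (ContinuousOn.mul ?_ ?_)
    · exact Real.continuous_exp.comp_continuousOn
        ((((Complex.continuous_re.comp_continuousOn (hL.mono fun z hz => hz.1)).sub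
          continuousOn_const)).const_smul (-(5 / 8 : ℝ)))
    · exact ContinuousOn.rpow_const (Φ.continuousOn.mono fun z hz => hz.1).norm
        fun z hz => Or.inl (hΦn0 z hz.1)
  have hWle : ∀ z ∈ S, ‖W z‖ ≤ Real.exp ((5 / 8 : ℝ) * Lb.re) * Ch ^ (11 / 8 : ℝ) := by
    intro z hz
    have hza := hSa hz
    have hhz : 0 < ‖h z‖ := norm_pos_iff.2 (hh0 z hza)
    have hh'z : 0 < ‖deriv h z‖ := norm_pos_iff.2 (hh'0 z hza.2)
    have hnΦ' : ‖deriv Φ z‖ = ‖deriv h z‖ / ‖h z‖ ^ 2 := by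
      rw [hΦ' z hza, norm_div, norm_neg, norm_pow]
    have hnΦ : ‖Φ z‖ = ‖h z‖⁻¹ := by rw [hΦinv z hza, norm_inv]
    have hEL : Real.exp ((L z).re) = ‖deriv Φ z‖ := by rw [← Complex.norm_exp, hexp z hz.1]
    have hE5 : Real.exp (-(5 / 8 : ℝ) * ((L z).re - Lb.re)) =
        ‖deriv Φ z‖ ^ (-(5 / 8 : ℝ)) * Real.exp ((5 / 8 : ℝ) * Lb.re) := by
      rw [show -(5 / 8 : ℝ) * ((L z).re - Lb.re) = (L z).re * (-(5 / 8 : ℝ)) + (5 / 8 : ℝ) * Lb.re by ring,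
        Real.exp_add, Real.exp_mul, hEL]
    have hWz : W z = Real.exp ((5 / 8 : ℝ) * Lb.re) * ‖deriv h z‖ ^ (11 / 8 : ℝ) := by
      simp only [hW]
      rw [hE5, hnΦ', hnΦ, ← root_weight_identity hh'z hhz]
      ring
    rw [Real.norm_eq_abs, abs_of_nonneg (by rw [hWz]; positivity), hWz]
    exact mul_le_mul_of_nonneg_left (Real.rpow_le_rpow (norm_nonneg _) (hCh z (hSb hz)) (by norm_num))
      (Real.exp_pos _).le
  have hgS : IntegrableOn g S := (hgi _ (isCompact_closedBall a (R₀ / 2))).mono_set fun z hz => ⟨hSb hz, hz.1⟩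
  have h1 : IntegrableOn (fun z => W z * ‖g z‖) S :=
    Integrable.bdd_mul (c := Real.exp ((5 / 8 : ℝ) * Lb.re) * Ch ^ (11 / 8 : ℝ)) hgS.norm
      (hWc.aestronglyMeasurable hSm) ((ae_restrict_iff' hSm).2 (Eventually.of_forall hWle))
  refine h1.congr_fun (fun z hz => ?_) hSm
  have hzΩ : z ∈ D.carrier := hz.1
  rw [Literature.Analysis.Complex.LengthArea.det_restrictScalars_smulRight, abs_of_nonneg (by positivity),
    smul_eq_mul, hK _ (Φ.mapsTo hzΩ), Φ.symm_apply_apply hzΩ, norm_mul, Complex.norm_exp]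
  simp only [hW]
  have : (-(5 / 8 : ℂ) * (L z - Lb)).re = -(5 / 8 : ℝ) * ((L z).re - Lb.re) := by
    simp [Complex.mul_re]
  rw [this]; ring

/-! ### Registered form -/

/-- **Registered helper `transport_rootDecay`** (∀-closed form of `root_decay`; sub-goal F5b of
stub `transportRigidity` (E), crux stmt-CriticalPhenomena-14004, line `polygon-parity-squeeze`).
[cite: PommerenkeBBCM1992, Thm. 2.6] -/
theorem transport_rootDecay : ∀ (D : DobrushinDomain) (Φ : ConformalEquiv D.carrier UpperHalfPlane.upperHalfPlaneSet) (Φs L : ℂ → ℂ) (Lb : ℂ) (g : ℂ → ℂ) (r₀ : ℝ) (K : ℂ → ℂ), Filter.Tendsto (fun z => ‖Φ z‖) (𝓝[D.carrier] (D.pt 0)) Filter.atTop → Φ.HasBoundaryValue (D.pt 1) 0 → ContinuousOn Φs (closure D.carrier \ {D.pt 0}) → Set.EqOn Φs Φ D.carrier → ContinuousOn L D.carrier → (∀ z ∈ D.carrier, Complex.exp (L z) = deriv Φ z) → (∀ K' : Set ℂ, IsCompact K' → MeasureTheory.IntegrableOn g (K' ∩ D.carrier)) → 0 < r₀ → D.carrier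 ∩ Metric.ball (D.pt 0) r₀ = {z : ℂ | (D.pt 0).im < z.im} ∩ Metric.ball (D.pt 0) r₀ → (∀ w : ℂ, 0 < w.im → K w = g (Φ.symm w) * Complex.exp (-(5 / 8 : ℂ) * (L (Φ.symm w) - Lb))) → ∃ R : ℝ, MeasureTheory.IntegrableOn (fun w => ‖K w‖ * ‖w‖ ^ (-(11 / 4 : ℝ))) ({w : ℂ | 0 < w.im} ∩ {w : ℂ | R < ‖w‖}) :=
  fun D Φ _Φs _L _Lb _g _r₀ _K hΦ0 hΦ1 hΦsc hΦse hL hexp hgi hr₀ hflat hK =>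
    root_decay D Φ hΦ0 hΦ1 hΦsc hΦse hL hexp hgi hr₀ hflat hK

end Transport

end Summit.CriticalPhenomena.SAWScalingLimit.Theorems.PolygonParitySqueeze
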